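import Summits.HubbardSuperconductivity.HubbardSuperconductivity.Theorems.BalabanIRBirEveryGroundStateTransfer
import Summits.HubbardSuperconductivity.HubbardSuperconductivity.Theorems.BalabanIRBirEveryGroundStateAffine
import Summits.HubbardSuperconductivity.HubbardSuperconductivity.Theorems.BalabanIRBirEveryGroundStateSocketClosers
import Summits.HubbardSuperconductivity.HubbardSuperconductivity.Theorems.BalabanIRBirEveryGroundStateStubSectorSpectralCurve
import Summits.HubbardSuperconductivity.HubbardSuperconductivity.Theorems.BalabanIRBirEveryGroundStateAnchorNonexceptional
import Summits.HubbardSuperconductivity.HubbardSuperconductivity.Theorems.BalabanIRBirEveryGroundStateStubLinearSheetForcesAffineGround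
import Summits.HubbardSuperconductivity.HubbardSuperconductivity.Theorems.BalabanIRBirEveryGroundStateStubLiebAnchor

/-!
# Crux `BirEveryGroundState` (stmt-HubbardSuperconductivity-2083) — LINE `spectral-curve-anchor`
# proof skeleton (line lead, seat prover-line-stmt-HubbardSuperconductivity-2083-0)

Composition: every window `(U₁, U₂)` contains a coupling `U` non-exceptional for all torus sides
(`exists_coupling_forall_card_roots_le_hubbardTorus`, inside the socket
`birEveryGroundState_of_avgToMin_at_nonexceptional`). At such a `U`, for the sector pencil
`T_L + u D_L` (hopping + `u` · doublon number) restricted to `S_L = szSector N_L 0`: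

* `stub_sectorSpectralCurve` — the SECTOR spectral curve `χ_L ∈ ℂ[u][λ]` (monic, divides the
  Fock-space pencil's characteristic polynomial, roots = eigenvalues with eigenvectors in `S_L`,
  real multiplicities = dimensions of `S_L ⊓ eigenspace`, every root lies on an irreducible factor);
* `stub_groundSheetAnchored` — THE HARD STUB (Hubbard-specific): eventually in even `L`, the
  irreducible component of `χ_L` through the ground point `(U, e₀(U, L))` is ANCHORED (has a simple
  point somewhere in `ℂ²`) unless the ground point lies on a LINEAR sheet `λ = ε + γ u`;
* anchored case: `stub_anchorTransferNonexceptional` (anchor + non-exceptional `U` ⇒ the ground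
  root is simple) ⇒ `dim E₀(U, L) = 1` ⇒ the window average is carried by every ground state;
* linear case: `stub_linearSheetForcesAffineGround` (a linear sheet through the ground point at a
  non-exceptional coupling IS the ground energy nearby) ⇒ midpoint equality ⇒
  `hubbard_jointEigen_of_midpoint` ⇒ every ground state is a doublon eigenvector, contradicting
  `stub_noJointEigenGround` (Hubbard-specific: no "T/U" ground state under the average bound);
* `stub_liebAnchor` — anchor supply (Lieb's simple attractive ground state as a simple point of
  the sector curve); recorded for the attack on `stub_groundSheetAnchored`, not used in `_of`.

STATUS after wave 1 (2026-08-16): `stub_sectorSpectralCurve` LANDED (p86818,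
`Theorems.BalabanIRBirEveryGroundStateStubSectorSpectralCurve`), `stub_anchorTransferNonexceptional`
LANDED (seat 3, `Theorems.BalabanIRBirEveryGroundStateAnchorNonexceptional`),
`stub_linearSheetForcesAffineGround` LANDED (p86966, `…StubLinearSheetForcesAffineGround`),
`stub_liebAnchor` LANDED (p87011, `…StubLiebAnchor`) — the four are now IMPORTED and used by name;
`stub_noJointEigenGround` RESHAPED (weakened to the form the composition needs: not ALL ground states
are doublon eigenvectors with a common eigenvalue; worker reply `stub-blocked` on the Hubbard-specific
fact "an all-T/U sector ground eigenspace is d-wave subcritical", helper p89708 landed);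
`stub_groundSheetAnchored` OPEN (lead).
-/

noncomputable section

set_option linter.dupNamespace false

namespace Summit.HubbardSuperconductivity.HubbardSuperconductivity.Cruxes.BirEveryGroundState.SpectralCurveAnchor

open Polynomial Matrix Finset Filter
open scoped Polynomial ComplexOrder
open Literature.Probability.LatticeModels Literature.MathematicalPhysics.QuantumLattice
open Literature.Computability.AlgebraicComplexity
open Summit.HubbardSuperconductivity.HubbardSuperconductivity.Theorems
open Summit.HubbardSuperconductivity.HubbardSuperconductivity.Theses.BalabanIR

/-! ## Stubs -/

/-- STUB (Hubbard-specific, OPEN): NO "T/U" GROUND EIGENSPACE UNDER THE AVERAGE BOUND (reshaped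
after wave 1 to exactly what the composition consumes). At a coupling `U > 0` non-exceptional for
all sides, if eventually in even `L` the ground-state AVERAGE of `Δ_d† Δ_d` is `≥ c L⁴`, then
eventually in even `L` the sector ground states of `hubbardTorus 2 L 1 U` are NOT all eigenvectors of
the doublon number `Σ_x n_{x↑} n_{x↓}` with one common eigenvalue (such ground states are joint
eigenvectors of hopping and interaction — "T/U states", Bruus–Anglès d'Auriac 1997 §5.2). What is
known (worker, p89708 `extendedSWave_dark_of_eigen_doublonFree`): a doublon-FREE hopping eigenvector
is killed by every bond-star singlet sum, hence extended-s dark — but NOT d-dark in general (explicit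
two-particle zero modes with `Δ_d ψ ≠ 0`), so even the doublon-free case needs the AVERAGE bound; the
missing Hubbard-specific fact is "a sector ground eigenspace consisting of T/U states is d-wave
subcritical". NOT in print. -/
theorem stub_noJointEigenGround : ∀ δ ∈ Set.Ioo (0:ℝ) (1/2), ∀ U : ℝ, 0 < U →
    (∀ (L : ℕ) (u' : ℝ), (hubbardTorus 2 L 1 u').charpoly.roots.toFinset.card ≤
      (hubbardTorus 2 L 1 U).charpoly.roots.toFinset.card) →
    ∀ c : ℝ, 0 < c →
    (∃ L₀ : ℕ, ∀ (L : ℕ) [NeZero L], L₀ ≤ L → Even L →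
      let N : ℕ := 2 * ⌊(1 - δ) * (L : ℝ) ^ 2 / 2⌋₊
      let H := hubbardTorus 2 L 1 U
      let S := szSector (Λ := FermionTorus 2 L) N 0
      let E₀ := S ⊓ Module.End.eigenspace (Matrix.toLin' H) ((H.minEnergyOn S : ℝ) : ℂ)
      let P := projMatrix (E₀.map (Fock.toEuclidean (ι := Orb (FermionTorus 2 L)) :
        Fock (Orb (FermionTorus 2 L)) →ₗ[ℂ] EuclideanSpace ℂ (Finset (Orb (FermionTorus 2 L)))))
      c * (L : ℝ) ^ 4 * P.trace.re ≤
        (P * ((pairField dWaveFormFactor L)ᴴ * pairField dWaveFormFactor L)).trace.re) →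
    ∃ L₀ : ℕ, ∀ (L : ℕ) [NeZero L], L₀ ≤ L → Even L →
      let N : ℕ := 2 * ⌊(1 - δ) * (L : ℝ) ^ 2 / 2⌋₊
      ∀ γ : ℂ, ¬ ∀ ψ : Fock (Orb (FermionTorus 2 L)),
        IsGroundStateInSector (hubbardTorus 2 L 1 U) N 0 ψ →
          (∑ x : FermionTorus 2 L, numberOp x 0 * numberOp x 1 :
            Matrix (Finset (Orb (FermionTorus 2 L))) (Finset (Orb (FermionTorus 2 L))) ℂ) *ᵥ ψ =
              γ • ψ := by
  sorry

/-- STUB (Hubbard-specific, OPEN — the line's HARDEST stub, "CONNECTIVITY"): THE GROUND SHEET IS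
ANCHORED OR LINEAR. At a coupling `U > 0` non-exceptional for all sides, under the eventual
average bound, eventually in even `L`: for the sector spectral curve `χ_L` of the pencil
`hubbardTorus 2 L 1 0 + u · (doublon number)` on `S_L = szSector N_L 0` (characterised by its roots
and real multiplicities), every irreducible factor `p` of `χ_L` vanishing at the ground point
`(U, e₀(U, L))` either has an ANCHOR (a specialised root, at some complex coupling, that is a simple
root of `χ_L` there) or the ground point lies on a LINEAR sheet `λ = ε + γ u` of `χ_L`. (Anchors in
hand: Lieb's attractive ground state, `stub_liebAnchor`; free levels simple in the sector; the open
content is that the repulsive window's ground sheet lies on an anchored component.) NOT in print. -/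
theorem stub_groundSheetAnchored : ∀ δ ∈ Set.Ioo (0:ℝ) (1/2), ∀ U : ℝ, 0 < U →
    (∀ (L : ℕ) (u' : ℝ), (hubbardTorus 2 L 1 u').charpoly.roots.toFinset.card ≤
      (hubbardTorus 2 L 1 U).charpoly.roots.toFinset.card) →
    ∀ c : ℝ, 0 < c →
    (∃ L₀ : ℕ, ∀ (L : ℕ) [NeZero L], L₀ ≤ L → Even L →
      let N : ℕ := 2 * ⌊(1 - δ) * (L : ℝ) ^ 2 / 2⌋₊
      let H := hubbardTorus 2 L 1 U
      let S := szSector (Λ := FermionTorus 2 L) N 0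
      let E₀ := S ⊓ Module.End.eigenspace (Matrix.toLin' H) ((H.minEnergyOn S : ℝ) : ℂ)
      let P := projMatrix (E₀.map (Fock.toEuclidean (ι := Orb (FermionTorus 2 L)) :
        Fock (Orb (FermionTorus 2 L)) →ₗ[ℂ] EuclideanSpace ℂ (Finset (Orb (FermionTorus 2 L)))))
      c * (L : ℝ) ^ 4 * P.trace.re ≤
        (P * ((pairField dWaveFormFactor L)ᴴ * pairField dWaveFormFactor L)).trace.re) →
    ∃ L₀ : ℕ, ∀ (L : ℕ) [NeZero L], L₀ ≤ L → Even L →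
      let N : ℕ := 2 * ⌊(1 - δ) * (L : ℝ) ^ 2 / 2⌋₊
      let T := hubbardTorus 2 L 1 0
      let D : Matrix (Finset (Orb (FermionTorus 2 L))) (Finset (Orb (FermionTorus 2 L))) ℂ :=
        ∑ x : FermionTorus 2 L, numberOp x 0 * numberOp x 1
      let S := szSector (Λ := FermionTorus 2 L) N 0
      let e₀ : ℝ := (hubbardTorus 2 L 1 U).minEnergyOn S
      ∀ χ : ℂ[X][X], χ.Monic →
        (∀ u μ : ℂ, (χ.map (evalRingHom u)).IsRoot μ ↔ ∃ v ∈ S, v ≠ 0 ∧ (T + u • D) *ᵥ v = μ • v) →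
        (∀ u μ : ℝ, (χ.map (evalRingHom (u : ℂ))).rootMultiplicity (μ : ℂ) =
          Module.finrank ℂ ↥(S ⊓ Module.End.eigenspace (Matrix.toLin' (T + (u : ℂ) • D)) (μ : ℂ))) →
        ∀ p : ℂ[X][X], Irreducible p → p ∣ χ → (p.map (evalRingHom (U : ℂ))).IsRoot ((e₀ : ℝ) : ℂ) →
          (∃ U₀ μ₀ : ℂ, (p.map (evalRingHom U₀)).IsRoot μ₀ ∧
            (χ.map (evalRingHom U₀)).rootMultiplicity μ₀ = 1) ∨
          (∃ ε γ : ℂ, (X - C (C ε + C γ * X)) ∣ χ ∧ ((e₀ : ℝ) : ℂ) = ε + γ * (U : ℂ)) := by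
  sorry

/-! ## Glue (sorry-free) -/

/-- Pencil form of the Hubbard torus Hamiltonian: `H(U) = H(0) + U · Σ_x n_{x↑} n_{x↓}`. [folklore] -/
theorem hubbardTorus_eq_pencil (L : ℕ) (u : ℝ) :
    hubbardTorus 2 L 1 u = hubbardTorus 2 L 1 0 +
      (u : ℂ) • (∑ x : FermionTorus 2 L, numberOp x 0 * numberOp x 1 :
        Matrix (Finset (Orb (FermionTorus 2 L))) (Finset (Orb (FermionTorus 2 L))) ℂ) :=
  hamiltonian_eq_add_smul_doublon (fermionTorusGraph 2 L) 1 u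

/-- In a one-dimensional subspace every matrix has scalar matrix elements. [folklore] -/
theorem exists_scalar_of_finrank_eq_one {n : Type} [Fintype n] [DecidableEq n]
    (E : Submodule ℂ (n → ℂ)) (hE : Module.finrank ℂ E = 1) (A : Matrix n n ℂ) :
    ∃ μ : ℂ, ∀ v ∈ E, ∀ w ∈ E, star w ⬝ᵥ A *ᵥ v = μ * (star w ⬝ᵥ v) := by
  obtain ⟨e, he0, hspan⟩ := (finrank_eq_one_iff' (K := ℂ) (V := E)).mp hE
  refine ⟨(star (e : n → ℂ) ⬝ᵥ A *ᵥ (e : n → ℂ)) / (star (e : n → ℂ) ⬝ᵥ (e : n → ℂ)),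
    fun v hv w hw => ?_⟩
  have he0' : star (e : n → ℂ) ⬝ᵥ (e : n → ℂ) ≠ 0 :=
    fun h0 => he0 (Subtype.ext (dotProduct_star_self_eq_zero.mp h0))
  obtain ⟨a, ha⟩ := hspan ⟨v, hv⟩
  obtain ⟨b, hb⟩ := hspan ⟨w, hw⟩
  have hav : v = a • (e : n → ℂ) := by simpa using congrArg Subtype.val ha.symm
  have hbw : w = b • (e : n → ℂ) := by simpa using congrArg Subtype.val hb.symm
  rw [hav, hbw, star_smul, mulVec_smul, dotProduct_smul, smul_dotProduct, smul_dotProduct,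
    dotProduct_smul]
  simp only [smul_eq_mul]
  field_simp

/-- Pigeonhole over an orthonormal frame: if the compression of `A` to `E₀` is scalar and the
average of `A` over `E₀` is at least `a` (in the route's `projMatrix` currency), then every unit
vector of `E₀` has `a ≤ re ⟨ψ, A ψ⟩`. (Inlined from `birEveryGroundState_structural_of_scalarOnGround`.)
[folklore] -/
theorem unit_bound_of_scalar_of_average {n : Type} [Fintype n] [DecidableEq n]
    (E₀ : Submodule ℂ (n → ℂ)) (A : Matrix n n ℂ) (a : ℝ)
    (hscal : ∃ μ : ℂ, ∀ v ∈ E₀, ∀ w ∈ E₀, star w ⬝ᵥ A *ᵥ v = μ * (star w ⬝ᵥ v))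
    (havg : a * (projMatrix (E₀.map ((WithLp.linearEquiv 2 ℂ (n → ℂ)).symm :
        (n → ℂ) →ₗ[ℂ] EuclideanSpace ℂ n))).trace.re ≤
      (projMatrix (E₀.map ((WithLp.linearEquiv 2 ℂ (n → ℂ)).symm :
        (n → ℂ) →ₗ[ℂ] EuclideanSpace ℂ n)) * A).trace.re)
    {ψ : n → ℂ} (hψE : ψ ∈ E₀) (hunit : star ψ ⬝ᵥ ψ = 1) :
    a ≤ (star ψ ⬝ᵥ A *ᵥ ψ).re := by
  -- an orthonormal frame of `E₀`; the projection is `B Bᴴ`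
  obtain ⟨k, B, hk, hBB, hcol, hfix⟩ := exists_orthonormalFrame E₀
  have hP : projMatrix (E₀.map ((WithLp.linearEquiv 2 ℂ (n → ℂ)).symm :
      (n → ℂ) →ₗ[ℂ] EuclideanSpace ℂ n)) = B * Bᴴ :=
    proj_unique (projMatrix_isHermitian _) (Matrix.isHermitian_mul_conjTranspose_self B)
      (fun _ hw => projMatrix_map_mulVec_of_mem E₀ hw) (projMatrix_map_mulVec_mem E₀) hfix
      (frame_proj_mulVec_mem hcol)
  have hdiag : ∀ j : Fin k,
      (Bᴴ * (A * B)) j j = star (fun x => B x j) ⬝ᵥ A *ᵥ (fun x => B x j) := by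
    intro j
    simp only [Matrix.mul_apply, Matrix.conjTranspose_apply, dotProduct, Matrix.mulVec,
      Pi.star_apply]
  have hunitB : ∀ j : Fin k, star (fun x => B x j) ⬝ᵥ (fun x => B x j) = 1 := by
    intro j
    have := congrFun (congrFun hBB j) j
    simpa [Matrix.mul_apply, Matrix.conjTranspose_apply, dotProduct, Matrix.one_apply] using this
  have hkpos : 0 < k := by
    rw [hk]
    refine Submodule.one_le_finrank_iff.mpr ((Submodule.ne_bot_iff _).mpr ⟨ψ, hψE, ?_⟩)
    rintro rfl
    simp at hunit
  rw [hP, frame_proj_trace hBB, Matrix.mul_assoc, Matrix.trace_mul_comm, Matrix.mul_assoc,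
    Matrix.trace] at havg
  simp only [Matrix.diag_apply, Complex.re_sum, Complex.natCast_re] at havg
  have hsum : ∑ _j : Fin k, a ≤ ∑ j : Fin k, ((Bᴴ * (A * B)) j j).re := by
    simpa [mul_comm] using havg
  haveI : Nonempty (Fin k) := ⟨⟨0, hkpos⟩⟩
  obtain ⟨j, -, hj⟩ := Finset.exists_le_of_sum_le Finset.univ_nonempty hsum
  rw [hdiag] at hj
  obtain ⟨μ, hμ⟩ := hscal
  rw [hμ _ (hcol j) _ (hcol j), hunitB, mul_one] at hj
  rw [hμ ψ hψE ψ hψE, hunit, mul_one]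
  exact hj

/-! ## Composition -/

/-- THE LINE: the six stubs imply the crux `BirEveryGroundState` BY NAME. -/
theorem BirEveryGroundState_of : BirEveryGroundState := by
  refine birEveryGroundState_of_avgToMin_at_nonexceptional fun δ hδ U hU hmax c hc havg => ?_
  obtain ⟨L₅, hL₅⟩ := stub_noJointEigenGround δ hδ U hU hmax c hc havg
  obtain ⟨L₆, hL₆⟩ := stub_groundSheetAnchored δ hδ U hU hmax c hc havg
  obtain ⟨L₂, hL₂⟩ := havg
  refine ⟨c, hc, max L₂ (max L₅ L₆), fun L _ hL hLe ψ hgs hunit => ?_⟩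
  have hL2 : L₂ ≤ L := (le_max_left _ _).trans hL
  have hL5 : L₅ ≤ L := ((le_max_left _ _).trans (le_max_right _ _)).trans hL
  have hL6 : L₆ ≤ L := ((le_max_right _ _).trans (le_max_right _ _)).trans hL
  -- the objects of side `L`
  set m : ℕ := ⌊(1 - δ) * (L : ℝ) ^ 2 / 2⌋₊ with hm
  set T : Matrix (Finset (Orb (FermionTorus 2 L))) (Finset (Orb (FermionTorus 2 L))) ℂ :=
    hubbardTorus 2 L 1 0 with hT
  set D : Matrix (Finset (Orb (FermionTorus 2 L))) (Finset (Orb (FermionTorus 2 L))) ℂ :=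
    ∑ x : FermionTorus 2 L, numberOp x 0 * numberOp x 1 with hD
  set S : Submodule ℂ (Fock (Orb (FermionTorus 2 L))) :=
    szSector (Λ := FermionTorus 2 L) (2 * m) 0 with hS
  set A : Matrix (Finset (Orb (FermionTorus 2 L))) (Finset (Orb (FermionTorus 2 L))) ℂ :=
    (pairField dWaveFormFactor L)ᴴ * pairField dWaveFormFactor L with hA
  have hpen : ∀ u : ℝ, hubbardTorus 2 L 1 u = T + (u : ℂ) • D := fun u =>
    hubbardTorus_eq_pencil L u
  set H : Matrix (Finset (Orb (FermionTorus 2 L))) (Finset (Orb (FermionTorus 2 L))) ℂ :=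
    hubbardTorus 2 L 1 U with hH
  have hHpen : H = T + (U : ℂ) • D := hpen U
  set e₀ : ℝ := H.minEnergyOn S with he₀
  set E₀ : Submodule ℂ (Fock (Orb (FermionTorus 2 L))) :=
    S ⊓ Module.End.eigenspace (Matrix.toLin' H) ((e₀ : ℝ) : ℂ) with hE₀
  -- Hermiticity and invariance of the pencil members
  have hTh : T.IsHermitian := LiebThm1.hamiltonian_isHermitian (fermionTorusGraph 2 L) 1 0
  have hDh : D.IsHermitian := doublon_isHermitian
  have hTK : ∀ v ∈ S, T *ᵥ v ∈ S := fun v hv =>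
    hamiltonian_mulVec_mem_szSector (fermionTorusGraph 2 L) 1 0 m hv
  have hDK : ∀ v ∈ S, D *ᵥ v ∈ S := fun v hv => doublon_mulVec_mem_szSector m hv
  -- the ground state `ψ`
  obtain ⟨hψS, hψ0, hHψ⟩ := hgs
  have hψE : ψ ∈ E₀ := by
    refine Submodule.mem_inf.mpr ⟨hψS, ?_⟩
    rw [Module.End.mem_eigenspace_iff, Matrix.toLin'_apply]
    exact hHψ
  -- the window average at side `L`
  have havgL := hL₂ L hL2 hLe
  simp only at havgL
  have hmap : E₀.map (Fock.toEuclidean (ι := Orb (FermionTorus 2 L)) :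
      Fock (Orb (FermionTorus 2 L)) →ₗ[ℂ] EuclideanSpace ℂ (Finset (Orb (FermionTorus 2 L)))) =
      E₀.map ((WithLp.linearEquiv 2 ℂ (Finset (Orb (FermionTorus 2 L)) → ℂ)).symm :
        (Finset (Orb (FermionTorus 2 L)) → ℂ) →ₗ[ℂ]
          EuclideanSpace ℂ (Finset (Orb (FermionTorus 2 L)))) := rfl
  rw [hmap] at havgL
  -- it suffices that the compression of `A` to `E₀` be scalar
  suffices hscal : ∃ μ : ℂ, ∀ v ∈ E₀, ∀ w ∈ E₀, star w ⬝ᵥ A *ᵥ v = μ * (star w ⬝ᵥ v) by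
    exact unit_bound_of_scalar_of_average E₀ A _ hscal havgL hψE hunit
  -- the sector spectral curve
  obtain ⟨χ, hχm, hroots, hmult, hirr⟩ := stub_sectorSpectralCurve T D hTh hDh S hTK hDK
  -- the ground point lies on the curve
  have hroot : (χ.map (evalRingHom (U : ℂ))).IsRoot ((e₀ : ℝ) : ℂ) := by
    rw [hroots]
    refine ⟨ψ, hψS, hψ0, ?_⟩
    rw [← hHpen]
    exact hHψ
  obtain ⟨p, hp, hpχ, hpU⟩ := hirr _ _ hroot
  -- the dichotomy of the hard stub
  have h6 := hL₆ L hL6 hLe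
  simp only at h6
  rcases h6 χ hχm hroots hmult p hp hpχ hpU with hanch | ⟨ε, γ, hlin, hεU⟩
  · -- ANCHORED: the ground root is simple, `dim E₀ = 1`, the compression is scalar
    set Ψ : ℂ[X][X] := (T.map C + (X : ℂ[X]) • D.map C).charpoly with hΨ
    have hΨm : Ψ.Monic := Matrix.charpoly_monic _
    have hΦm : (χ * Ψ).Monic := hχm.mul hΨm
    -- roots of `χ(u)` are eigenvalues of the full pencil, so `χ Ψ` and `Ψ` have the same
    -- distinct specialised roots
    have hrootsΦ : ∀ u : ℝ, ((χ * Ψ).map (evalRingHom (u : ℂ))).roots.toFinset =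
        (hubbardTorus 2 L 1 u).charpoly.roots.toFinset := by
      intro u
      have hΨu : Ψ.map (evalRingHom (u : ℂ)) = (hubbardTorus 2 L 1 u).charpoly := by
        rw [hΨ, charpoly_pencil_map_evalRingHom, ← hpen u]
      have hne : χ.map (evalRingHom (u : ℂ)) * (hubbardTorus 2 L 1 u).charpoly ≠ 0 :=
        mul_ne_zero (hχm.map _).ne_zero (Matrix.charpoly_monic _).ne_zero
      rw [Polynomial.map_mul, hΨu, roots_mul hne, Multiset.toFinset_add]
      refine Finset.union_eq_right.mpr fun μ hμ => ?_
      rw [Multiset.mem_toFinset, mem_roots (Matrix.charpoly_monic _).ne_zero, IsRoot.def,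
        eval_charpoly, ← Matrix.exists_mulVec_eq_zero_iff]
      rw [Multiset.mem_toFinset, mem_roots (hχm.map _).ne_zero, hroots] at hμ
      obtain ⟨v, -, hv0, hv⟩ := hμ
      refine ⟨v, hv0, ?_⟩
      rw [sub_mulVec, hpen u, hv]
      ext i
      simp [Matrix.scalar_apply, Pi.smul_apply]
    have hmax' : ∀ u' : ℝ,
        ((χ * Ψ).map (evalRingHom ((u' : ℝ) : ℂ))).roots.toFinset.card ≤
          ((χ * Ψ).map (evalRingHom (U : ℂ))).roots.toFinset.card := by
      intro u'
      rw [hrootsΦ, hrootsΦ]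
      exact hmax L u'
    have hsimple := stub_anchorTransferNonexceptional χ (χ * Ψ) p hχm hΦm (dvd_mul_right χ Ψ) hp
      hpχ hanch U hmax' ((e₀ : ℝ) : ℂ) hpU
    have hfin : Module.finrank ℂ E₀ = 1 := by
      rw [hE₀, hHpen, ← hmult U e₀, hsimple]
    exact exists_scalar_of_finrank_eq_one E₀ hfin A
  · -- LINEAR: the ground energy is affine near `U`, every ground state is a T/U state: excluded
    exfalso
    have hline : ∀ u : ℂ, ∃ v ∈ S, v ≠ 0 ∧ (T + u • D) *ᵥ v = (ε + γ * u) • v := by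
      intro u
      rw [← hroots]
      obtain ⟨r, hr⟩ := hlin
      rw [hr, Polynomial.map_mul, IsRoot.def, eval_mul]
      simp
    have hmaxT : ∀ u' : ℝ, (T + ((u' : ℝ) : ℂ) • D).charpoly.roots.toFinset.card ≤
        (T + (U : ℂ) • D).charpoly.roots.toFinset.card := by
      intro u'
      rw [← hpen u', ← hpen U]
      exact hmax L u'
    have hεU' : (((T + (U : ℂ) • D).minEnergyOn S : ℝ) : ℂ) = ε + γ * (U : ℂ) := by
      rw [← hHpen]; exact hεU
    obtain ⟨η, hη, haff⟩ := stub_linearSheetForcesAffineGround T D hTh hDh S hTK hDK U hmaxT ε γ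
      hεU' hline
    -- midpoint equality with step `η / 2`
    have hη2 : η / 2 ≠ 0 := by positivity
    have hm_mem : U - η / 2 ∈ Set.Ioo (U - η) (U + η) := by constructor <;> linarith
    have hp_mem : U + η / 2 ∈ Set.Ioo (U - η) (U + η) := by constructor <;> linarith
    have hU_mem : U ∈ Set.Ioo (U - η) (U + η) := by constructor <;> linarith
    have em : (((T + ((U - η / 2 : ℝ) : ℂ) • D).minEnergyOn
        (szSector (Λ := FermionTorus 2 L) (2 * m) 0) : ℝ) : ℂ) = ε + γ * ((U - η / 2 : ℝ) : ℂ) :=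
      haff _ hm_mem
    have ep : (((T + ((U + η / 2 : ℝ) : ℂ) • D).minEnergyOn
        (szSector (Λ := FermionTorus 2 L) (2 * m) 0) : ℝ) : ℂ) = ε + γ * ((U + η / 2 : ℝ) : ℂ) :=
      haff _ hp_mem
    have eU : (((T + (U : ℂ) • D).minEnergyOn
        (szSector (Λ := FermionTorus 2 L) (2 * m) 0) : ℝ) : ℂ) = ε + γ * (U : ℂ) :=
      haff _ hU_mem
    have hmid : 2 * (hamiltonian (fermionTorusGraph 2 L) 1 U).minEnergyOn (szSector (2 * m) 0) ≤
        (hamiltonian (fermionTorusGraph 2 L) 1 (U - η / 2)).minEnergyOn (szSector (2 * m) 0) +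
          (hamiltonian (fermionTorusGraph 2 L) 1 (U + η / 2)).minEnergyOn (szSector (2 * m) 0) := by
      have h1 : hamiltonian (fermionTorusGraph 2 L) 1 U = T + (U : ℂ) • D := hpen U
      have h2 : hamiltonian (fermionTorusGraph 2 L) 1 (U - η / 2) = T + ((U - η / 2 : ℝ) : ℂ) • D :=
        hpen (U - η / 2)
      have h3 : hamiltonian (fermionTorusGraph 2 L) 1 (U + η / 2) = T + ((U + η / 2 : ℝ) : ℂ) • D :=
        hpen (U + η / 2)
      rw [h1, h2, h3]
      apply le_of_eq
      apply Complex.ofReal_injective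
      rw [Complex.ofReal_mul, Complex.ofReal_add, em, ep, eU]
      push_cast
      ring
    -- every sector ground state is a doublon eigenvector with one common eigenvalue: excluded
    have h5 := hL₅ L hL5 hLe
    simp only at h5
    exact h5 _ fun ψ' hψ' =>
      (hubbard_jointEigen_of_midpoint (fermionTorusGraph 2 L) 1 m U (η / 2) hη2 hmid hψ').2.2.1

end Summit.HubbardSuperconductivity.HubbardSuperconductivity.Cruxes.BirEveryGroundState.SpectralCurveAnchor
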